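import Literature.Computability.Complexity.SuccinctWitnessesFromUWC
import Literature.Computability.Complexity.ACVecOver
import HarnessLib

/-!
# Williams' Theorem 3.2: the `ACC`-SAT instance `D` checking a guessed witness circuit

Third layer under the named fact `Williams2014_thm_3_2` (`Williams2014Transfer.lean`; R. Williams,
*Nonuniform ACC circuit lower bounds*, J. ACM 61 (2014), Thm. 3.2, pp. 12–13, rerun at
polynomial size in the proof of Thm. 1.1, p. 18). After the algorithm `A` of Lemma 3.1 has
produced `ACC` circuits `C'ₓ` printing the `i`-th clause of the succinct `3SAT` instance `F`
("these copies output three variable indices of length at most `n + c log n`, along with sign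
bits", p. 9) and a witness circuit `W` has been guessed, the machine `B` "constructs an ACC
CIRCUIT SAT instance `D` to verify that `W` is correct": "For the three variables, an assignment
is computed for them by evaluating the indices on three copies of `W`. Finally, `D` compares the
sign bits with the bits output by the copies of `W`, and outputs `0` iff the variable assignment
encoded by `W` satisfies the `i`th clause. Observe that `D` has `O(n S(2n) + S(3n))` size, depth
`2d + O(1)`, and `n + c log n` inputs" (p. 13), and "this algorithm for `L` accepts `x` iff `D`
is unsatisfiable … `D` is an unsatisfiable circuit, if and only if … `W` encod[es] a satisfying
assignment for `F`" (p. 9). This file builds `D` in the tree's circuit model and PROVES these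
three claims (structure, resources, semantics):

* `clauseBit w C : ClauseCoord w → Bool` — the fixed-width presentation of a `3`-clause `C`
  over variables `< 2ʷ` (per literal slot: occupied?, polarity, `w` index bits, least
  significant first as in `MetaComplexity.boolFunEquivFin`); `clauseMap w f` — the Boolean map
  "index bits of `i` ↦ bits of the clause `f i`" that the circuits `C'ₓ` compute (for
  `f = cl x`, `w = succinctWidth c |x|`, cf. `IsSuccinctReduction`);
* `clauseCheck wf cb` — the test wired into `D`, and `clauseCheck_clauseBit` — **proved**: on
  the bits of a genuine clause and `wf = W.eval` it is `Clause.eval W.assignment C`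
  (`Circuit.assignment`, `Williams2014Transfer.lean`);
* `acRealOver_witnessCheck` — **proved**: from realizations of the clause map (depth `d_G`,
  size `s_G`) and of the witness function (depth `d_W`, size `s_W`) over a basis `B ⊇ acBasis`,
  the map `i ↦ ¬ clauseCheck` is realized over `B` at depth `d_W + d_G + 4` with
  `s_G + 3 s_W + 20` gates (three copies of `W` behind one copy of the clause circuits, then
  equivalences with the sign bits, a disjunction and a negation; `ACVecOver`/`ACRealOver`
  calculus of `ACVecOver.lean`, `ACRealizeOver.lean`);
* `exists_witnessCheck_circuit`, `exists_satInstance` — **proved**: the circuit `D` over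
  `accBasis m` with these bounds, `D(i) = ¬ [clause f(i) is satisfied by W.assignment]`, and
  `¬ D.Satisfiable ↔ (succinctCNF c cl x).eval W.assignment = true` for a succinct reduction;
* `Circuit.exists_padInputs` — **proved**: a witness circuit on `k ≤ w` inputs is converted into
  one on exactly `w` inputs encoding the same assignment (depth `+ 3`, size `+ (w + 2)`), so
  that `D` may assume `W : Circuit (Fin w)` (the witnesses of `HasSuccinctAssignments` have
  `k ≤ succinctWidth c n` inputs).

Only circuits are constructed here; the machines `A` (Lemma 3.1) and `B` (Thm. 3.2), which
guess, encode and run these circuits through the `ACC`-SAT algorithm, are the remaining content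
of `Williams2014_thm_3_2`.

## References

* R. Williams, *Nonuniform ACC circuit lower bounds*, J. ACM 61(1) (2014) 2:1–2:32, §3: proof
  sketch p. 9, Lemma 3.1, proof of Thm. 3.2 (pp. 12–13), proof of Thm. 1.1 (p. 18)
  [Williams2014].
* H. Vollmer, *Introduction to Circuit Complexity*, Springer 1999, §1.2 (composition of
  circuits) [Vollmer1999].
-/

namespace Literature.Computability.Complexity

open _root_.Computability GateList Finset

/-! ### Clauses as fixed-width bit vectors -/

/-- Coordinates of the fixed-width presentation of a `3`-clause with `w`-bit variable indices:
a literal slot `ℓ : Fin 3` and a field — `inl false`: "slot `ℓ` is occupied", `inl true`: the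
polarity of literal `ℓ`, `inr j`: bit `j` of its variable index (Williams 2014, §3, p. 9:
"three variable indices of length at most `n + c log n`, along with sign bits"). [cite: Williams2014, §3 (p. 9)] -/
abbrev ClauseCoord (w : ℕ) : Type := Fin 3 × (Bool ⊕ Fin w)

/-- The `ℓ`-th literal of a clause, with the junk literal `(0, false)` beyond its length.
[folklore] -/
def Clause.litD (C : Clause ℕ) (ℓ : ℕ) : Literal ℕ := C.getD ℓ (0, false)

/-- In range, `litD` is the list entry. [folklore] -/
theorem Clause.litD_eq_getElem (C : Clause ℕ) {ℓ : ℕ} (h : ℓ < C.length) : C.litD ℓ = C[ℓ] := by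
  simp [Clause.litD, List.getD_eq_getElem?_getD, List.getElem?_eq_getElem h]

/-- **The bits of a clause** at index width `w`: occupancy, polarity and the binary digits
(least significant first) of the variable of each of the three literal slots.
[cite: Williams2014, §3 (p. 9)] -/
def clauseBit (w : ℕ) (C : Clause ℕ) : ClauseCoord w → Bool
  | (ℓ, Sum.inl false) => decide ((ℓ : ℕ) < C.length)
  | (ℓ, Sum.inl true) => (C.litD ℓ).2
  | (ℓ, Sum.inr j) => (C.litD ℓ).1.testBit j

/-- The number whose binary digits, least significant first, are `i` (the tree's enumeration
`MetaComplexity.boolFunEquivFin` of the Boolean cube). [folklore] -/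
def bitsVal {w : ℕ} (i : Fin w → Bool) : ℕ := (MetaComplexity.boolFunEquivFin w i : ℕ)

/-- `bitsVal i < 2 ^ w`. [folklore] -/
theorem bitsVal_lt {w : ℕ} (i : Fin w → Bool) : bitsVal i < 2 ^ w :=
  (MetaComplexity.boolFunEquivFin w i).2

/-- `bitsVal` inverts the enumeration of the cube. [folklore] -/
theorem bitsVal_symm_apply {w v : ℕ} (hv : v < 2 ^ w) :
    bitsVal ((MetaComplexity.boolFunEquivFin w).symm ⟨v, hv⟩) = v := by
  simp [bitsVal]

/-- The cube point with number `bitsVal i` is `i`. [folklore] -/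
theorem symm_bitsVal {w : ℕ} (i : Fin w → Bool) :
    (MetaComplexity.boolFunEquivFin w).symm ⟨bitsVal i, bitsVal_lt i⟩ = i := by
  simp [bitsVal]

/-- The bits of a cube point are the binary digits of its number. [folklore] -/
theorem testBit_bitsVal {w : ℕ} (i : Fin w → Bool) (j : Fin w) : (bitsVal i).testBit j = i j := by
  conv_rhs => rw [← symm_bitsVal i]
  rw [boolFunEquivFin_symm_apply]

/-- **The clause map** of a clause function `f : ℕ → Clause ℕ` at width `w`: the bits of the
index `i < 2ʷ` are sent to the bits of the clause `f i` — the Boolean map computed by the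
circuit `Cₓ` of Fact 3.1 / the `ACC` circuit `C'ₓ` of Lemma 3.1 (for `f = cl x`,
`w = succinctWidth c |x|`). [cite: Williams2014, Fact 3.1 and Lemma 3.1] -/
def clauseMap (w : ℕ) (f : ℕ → Clause ℕ) (i : Fin w → Bool) : ClauseCoord w → Bool :=
  clauseBit w (f (bitsVal i))

/-- `clauseMap` at the cube point numbered `v`. [folklore] -/
theorem clauseMap_symm_apply {w : ℕ} (f : ℕ → Clause ℕ) {v : ℕ} (hv : v < 2 ^ w) :
    clauseMap w f ((MetaComplexity.boolFunEquivFin w).symm ⟨v, hv⟩) = clauseBit w (f v) := by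
  rw [clauseMap, bitsVal_symm_apply]

/-- **The test wired into `D`**: given the bits `cb` of a clause and a witness function `wf` on
`w`-bit variable indices, does some occupied literal slot `ℓ` have `wf (index bits of ℓ)` equal
to its polarity? (Williams 2014, p. 13: "an assignment is computed for them by evaluating the
indices on three copies of `W`. Finally, `D` compares the sign bits with the bits output by the
copies of `W`".) [cite: Williams2014, proof of Thm. 3.2 (p. 13)] -/
def clauseCheck {w : ℕ} (wf : (Fin w → Bool) → Bool) (cb : ClauseCoord w → Bool) : Bool :=
  decide (∃ ℓ : Fin 3, cb (ℓ, Sum.inl false) = true ∧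
    wf (fun j => cb (ℓ, Sum.inr j)) = cb (ℓ, Sum.inl true))

/-- A circuit on `w` inputs, read at the binary digits of `v < 2ʷ`, returns the value its encoded
assignment gives to the variable `v` (`Circuit.assignment`, least significant bit first).
[folklore] -/
theorem Circuit.eval_testBit_eq_assignment {w : ℕ} (W : Circuit (Fin w)) {v : ℕ} (hv : v < 2 ^ w) :
    W.eval (fun j : Fin w => v.testBit j) = W.assignment v := by
  rw [Circuit.assignment_of_lt W hv]
  congr 1
  funext j
  rw [boolFunEquivFin_symm_apply]

/-- **Semantics of the test**: on the bits of a clause `C` with at most three literals on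
variables `< 2ʷ`, and the witness function `W.eval` of a circuit `W` on `w` inputs,
`clauseCheck` computes the truth value of `C` under the assignment encoded by `W`
(Williams 2014, p. 13: "outputs `0` iff the variable assignment encoded by `W` satisfies the
`i`th clause"). [cite: Williams2014, proof of Thm. 3.2 (p. 13)] -/
theorem clauseCheck_clauseBit {w : ℕ} (W : Circuit (Fin w)) {C : Clause ℕ} (hlen : C.length ≤ 3)
    (hvar : ∀ l ∈ C, l.1 < 2 ^ w) :
    clauseCheck W.eval (clauseBit w C) = Clause.eval W.assignment C := by
  rw [clauseCheck, Clause.eval, Bool.eq_iff_iff, decide_eq_true_iff, List.any_eq_true]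
  constructor
  · rintro ⟨ℓ, hocc, hval⟩
    simp only [clauseBit, decide_eq_true_eq] at hocc hval
    have hmem : C.litD ℓ ∈ C := by rw [Clause.litD_eq_getElem C hocc]; exact List.getElem_mem _
    refine ⟨C.litD ℓ, hmem, ?_⟩
    rw [Literal.eval, ← Circuit.eval_testBit_eq_assignment W (hvar _ hmem), hval]
    simp
  · rintro ⟨l, hl, hval⟩
    obtain ⟨ℓ, hℓ, rfl⟩ := List.mem_iff_getElem.1 hl
    refine ⟨⟨ℓ, lt_of_lt_of_le hℓ hlen⟩, ?_, ?_⟩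
    · simpa [clauseBit] using hℓ
    · simp only [clauseBit]
      rw [Clause.litD_eq_getElem C hℓ, Circuit.eval_testBit_eq_assignment W (hvar _ hl)]
      simpa [Literal.eval] using hval

/-! ### Realizing the test: three copies of `W`, comparisons, a disjunction, a negation -/

section Realize

variable {ι : Type*} {B : Set GateFn}

/-- Binary `∧` over `B ⊇ acBasis` (equal depths; depth `+ 1`, sizes add `+ 1`). [cite: Vollmer1999, §1.2] -/
theorem acRealOver_and₂ (hB : acBasis ⊆ B) {f g : (ι → Bool) → Bool} {d s t : ℕ}
    (hf : ACRealOver B f d s) (hg : ACRealOver B g d t) :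
    ACRealOver B (fun x => f x && g x) (d + 1) (s + t + 1) := by
  have h := acRealOver_forall hB (M := 2) (f := ![f, g]) (s := ![s, t])
    (fun j => by fin_cases j <;> simpa)
  refine (h.congr fun x => ?_).mono le_rfl (by simp [Fin.sum_univ_two])
  simp [Fin.forall_fin_two]

/-- Binary `∨` over `B ⊇ acBasis` (equal depths; depth `+ 1`, sizes add `+ 1`). [cite: Vollmer1999, §1.2] -/
theorem acRealOver_or₂ (hB : acBasis ⊆ B) {f g : (ι → Bool) → Bool} {d s t : ℕ}
    (hf : ACRealOver B f d s) (hg : ACRealOver B g d t) :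
    ACRealOver B (fun x => f x || g x) (d + 1) (s + t + 1) := by
  have h := acRealOver_exists hB (M := 2) (f := ![f, g]) (s := ![s, t])
    (fun j => by fin_cases j <;> simpa)
  refine (h.congr fun x => ?_).mono le_rfl (by simp [Fin.sum_univ_two])
  simp [Fin.exists_fin_two]

/-- The equivalence `[y a = y b]` of two inputs as `(a ∧ b) ∨ (¬a ∧ ¬b)`: depth `2`, `5` gates
(two of them free negations). [cite: Vollmer1999, §1.2] -/
theorem acRealOver_iff_inputs (hB : acBasis ⊆ B) (a b : ι) :
    ACRealOver B (fun y : ι → Bool => decide (y a = y b)) 2 5 := by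
  have hnot : GateFn.not ∈ B := hB mem_acBasis_not
  have h1 : ACRealOver B (fun y : ι → Bool => y a && y b) 1 1 :=
    (acRealOver_and₂ hB (acRealOver_input B a) (acRealOver_input B b)).mono le_rfl (by simp)
  have h2 : ACRealOver B (fun y : ι → Bool => !y a && !y b) 1 3 :=
    (acRealOver_and₂ hB (acRealOver_notInput hnot a) (acRealOver_notInput hnot b)).mono le_rfl
      (by simp)
  refine ((acRealOver_or₂ hB h1 h2).congr fun y => ?_).mono le_rfl (by simp)
  cases y a <;> cases y b <;> rfl

/-- The outputs of the first layer of the test, per literal slot `ℓ`: `0 ↦` the witness value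
`wf (index bits of ℓ)`, `1 ↦` the polarity bit, `2 ↦` the occupancy bit. [folklore] -/
def checkBlock {w : ℕ} (wf : (Fin w → Bool) → Bool) (p : Fin 3 × Fin 3) :
    (ClauseCoord w → Bool) → Bool :=
  ![fun cb => wf (fun j => cb (p.1, Sum.inr j)), fun cb => cb (p.1, Sum.inl true),
    fun cb => cb (p.1, Sum.inl false)] p.2

/-- The second layer of the test on the outputs `y` of the first: "no occupied slot whose
witness value equals its polarity". [folklore] -/
def checkGlue (y : Fin 3 × Fin 3 → Bool) : Bool :=
  !decide (∃ ℓ : Fin 3, y (ℓ, 2) = true ∧ y (ℓ, 0) = y (ℓ, 1))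

/-- The glue layer is realized over `B ⊇ acBasis` at depth `4` with `20` gates: per slot an
equivalence (depth `2`, `5` gates) and a conjunction with the occupancy bit, then one
disjunction and one (free) negation. [cite: Vollmer1999, §1.2] -/
theorem acRealOver_checkGlue (hB : acBasis ⊆ B) : ACRealOver B checkGlue 4 20 := by
  have hnot : GateFn.not ∈ B := hB mem_acBasis_not
  have hlit : ∀ ℓ : Fin 3, ACRealOver B
      (fun y : Fin 3 × Fin 3 → Bool => y (ℓ, 2) && decide (y (ℓ, 0) = y (ℓ, 1))) 3 6 := by
    intro ℓ
    have h0 : ACRealOver B (fun y : Fin 3 × Fin 3 → Bool => y (ℓ, 2)) 2 0 :=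
      (acRealOver_input B (ℓ, 2)).mono (Nat.zero_le 2) le_rfl
    exact (acRealOver_and₂ hB h0 (acRealOver_iff_inputs hB (ℓ, 0) (ℓ, 1))).mono le_rfl (by simp)
  have hex := acRealOver_exists_const hB hlit
  refine ((hex.neg hnot).congr fun y => ?_).mono le_rfl (by norm_num)
  simp only [checkGlue, Bool.and_eq_true, decide_eq_true_eq]

/-- The first layer of the test from a realization of the witness function `wf` (depth `d_W`,
size `s_W`): three copies of it, re-wired to the index bits of the three slots, next to the
(free) polarity and occupancy wires — depth `d_W`, `3 s_W` gates. [cite: Williams2014, proof of Thm. 3.2 (p. 13)] -/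
theorem acVecOver_checkBlock {w dW sW : ℕ} {wf : (Fin w → Bool) → Bool}
    (hW : ACRealOver B wf dW sW) :
    ACVecOver B (fun (cb : ClauseCoord w → Bool) p => checkBlock wf p cb) dW (3 * sW) := by
  let s : Fin 3 × Fin 3 → ℕ := fun p => ![sW, 0, 0] p.2
  have h : ∀ p : Fin 3 × Fin 3, ACRealOver B (checkBlock wf p) dW (s p) := by
    rintro ⟨ℓ, t⟩
    fin_cases t
    · simpa [checkBlock, s] using hW.rewire (fun j => (ℓ, Sum.inr j))
    · simpa [checkBlock, s] using (acRealOver_input B (ℓ, Sum.inl true)).mono (Nat.zero_le dW) le_rfl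
    · simpa [checkBlock, s] using (acRealOver_input B (ℓ, Sum.inl false)).mono (Nat.zero_le dW) le_rfl
  have hv := acVecOver_ofBlocks_fintype h
  refine hv.mono le_rfl (le_of_eq ?_)
  simp [s, Fintype.sum_prod_type, Fin.sum_univ_three]

/-- **The witness test is a constant-depth circuit on top of `W` and `C'ₓ`** (Williams 2014,
proof of Thm. 3.2, p. 13: "`D` has `O(n S(2n) + S(3n))` size, depth `2d + O(1)`"): if the clause
map `G` is realized over `B ⊇ acBasis` at depth `d_G` with `s_G` gates and the witness function
`wf` at depth `d_W` with `s_W` gates, then `i ↦ ¬ clauseCheck wf (G i)` is realized over `B` at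
depth `d_W + d_G + 4` with `s_G + 3 s_W + 20` gates. [cite: Williams2014, proof of Thm. 3.2 (p. 13)] -/
theorem acRealOver_witnessCheck (hB : acBasis ⊆ B) {w dG sG dW sW : ℕ}
    {G : (Fin w → Bool) → ClauseCoord w → Bool} {wf : (Fin w → Bool) → Bool}
    (hG : ACVecOver B G dG sG) (hW : ACRealOver B wf dW sW) :
    ACRealOver B (fun i => !clauseCheck wf (G i)) (dW + dG + 4) (sG + 3 * sW + 20) := by
  have hH : ACRealOver B (fun cb : ClauseCoord w → Bool => !clauseCheck wf cb) (4 + dW)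
      (20 + 3 * sW) := by
    refine ((acRealOver_checkGlue hB).compVec (acVecOver_checkBlock hW)).congr fun cb => ?_
    simp only [checkGlue, checkBlock, clauseCheck]
    rfl
  refine ((hH.compVec hG).congr fun i => rfl).mono (by omega) (by omega)

end Realize

/-! ### The circuit `D` and its unsatisfiability -/

/-- **The `ACC`-SAT instance `D` of Theorem 3.2** (Williams 2014, pp. 12–13): given circuits
over `accBasis m` for the clause map of `f` at width `w` (one copy, depth `≤ d_G`, `≤ s_G` gates
in total; the output circuits `C'ₓ` of Lemma 3.1) and a witness circuit `W` on `w` inputs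
(depth `≤ d_W`, `≤ s_W` gates), there is a circuit `D` on `w` inputs over `accBasis m` of depth
`≤ d_W + d_G + 4` and size `≤ s_G + 3 s_W + 20` with `D(i) = 0` iff the assignment encoded by
`W` satisfies the clause `f(i)`; hence `D` is unsatisfiable iff that assignment satisfies every
clause `f(v)`, `v < 2ʷ` — provided every clause has at most three literals on variables `< 2ʷ`.
[cite: Williams2014, proof of Thm. 3.2 (pp. 12–13)] -/
theorem exists_witnessCheck_circuit {m w dG sG dW sW : ℕ} {f : ℕ → Clause ℕ}
    (hG : ACVecOver (accBasis m) (clauseMap w f) dG sG) (W : Circuit (Fin w))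
    (hWB : W.IsOver (accBasis m)) (hWd : W.acDepth ≤ dW) (hWs : W.size ≤ sW)
    (hlen : ∀ v, (f v).length ≤ 3) (hvar : ∀ v, ∀ l ∈ f v, l.1 < 2 ^ w) :
    ∃ D : Circuit (Fin w), D.IsOver (accBasis m) ∧ D.acDepth ≤ dW + dG + 4 ∧
      D.size ≤ sG + 3 * sW + 20 ∧
      (∀ i, D.eval i = !(Clause.eval W.assignment (f (bitsVal i)))) ∧
      (¬ D.Satisfiable ↔ ∀ v < 2 ^ w, Clause.eval W.assignment (f v) = true) := by
  have hR := acRealOver_witnessCheck (acBasis_subset_accBasis m) hG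
    (ACRealOver.of_circuit W hWB hWd hWs)
  obtain ⟨D, hDB, hDd, hDs, hDe⟩ := hR.toCircuit
  have hev : ∀ i, D.eval i = !(Clause.eval W.assignment (f (bitsVal i))) := fun i => by
    rw [hDe i]
    change (!clauseCheck W.eval (clauseMap w f i)) = _
    simp only [clauseMap]
    rw [clauseCheck_clauseBit W (hlen _) (hvar _)]
  refine ⟨D, hDB, hDd, hDs, hev, ?_⟩
  constructor
  · intro h v hv
    by_contra hne
    refine h ⟨(MetaComplexity.boolFunEquivFin w).symm ⟨v, hv⟩, ?_⟩
    rw [hev, bitsVal_symm_apply hv]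
    simpa using hne
  · rintro h ⟨i, hi⟩
    rw [hev, h _ (bitsVal_lt i)] at hi
    simp at hi

/-- **`D` for a succinct reduction** (Williams 2014, proof of Thm. 3.2 with Fact 3.1; p. 9:
"there is a … circuit `W` such that `D` is an unsatisfiable circuit, if and only if there is such a
`W` encoding a satisfying assignment for `F_{Cₓ}`"): for `cl` a succinct reduction of `L` with
constant `c`, input `x`, width `w = succinctWidth c |x|`, `accBasis m`-circuits for the clause
map of `cl x` and a witness circuit `W` on `w` inputs, the circuit `D` of
`exists_witnessCheck_circuit` is unsatisfiable iff `W` encodes a satisfying assignment of the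
presented formula `succinctCNF c cl x`. [cite: Williams2014, proof of Thm. 3.2 (pp. 12–13)] -/
theorem exists_satInstance {c m : ℕ} {L : Language Bool} {cl : List Bool → ℕ → Clause ℕ}
    (hred : IsSuccinctReduction c L cl) (x : List Bool) {dG sG dW sW : ℕ}
    (hG : ACVecOver (accBasis m) (clauseMap (succinctWidth c x.length) (cl x)) dG sG)
    (W : Circuit (Fin (succinctWidth c x.length))) (hWB : W.IsOver (accBasis m))
    (hWd : W.acDepth ≤ dW) (hWs : W.size ≤ sW) :
    ∃ D : Circuit (Fin (succinctWidth c x.length)), D.IsOver (accBasis m) ∧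
      D.acDepth ≤ dW + dG + 4 ∧ D.size ≤ sG + 3 * sW + 20 ∧
      (∀ i, D.eval i = !(Clause.eval W.assignment (cl x (bitsVal i)))) ∧
      (¬ D.Satisfiable ↔ (succinctCNF c cl x).eval W.assignment = true) := by
  obtain ⟨D, hDB, hDd, hDs, hev, hsat⟩ := exists_witnessCheck_circuit hG W hWB hWd hWs
    (hred.length_le x) (hred.var_lt x)
  exact ⟨D, hDB, hDd, hDs, hev, hsat.trans eval_succinctCNF_eq_true_iff.symm⟩

/-! ### Witness circuits on exactly `w` inputs -/

/-- **Padding the inputs of a witness circuit** (bookkeeping for Thm. 3.2: the witnesses of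
`HasSuccinctAssignments` have `k ≤ w = succinctWidth c n` inputs, `D` reads `w`-bit indices):
a circuit `W` on `k ≤ w` inputs over `B ⊇ acBasis` becomes a circuit on `w` inputs over `B`,
"all high bits zero, and `W` on the low bits", of depth `≤ acDepth W + 3` and size
`≤ |W| + w + 2`, encoding the same assignment (`Circuit.assignment`: variables `≥ 2ᵏ` are
false). [folklore] -/
theorem Circuit.exists_padInputs {B : Set GateFn} (hB : acBasis ⊆ B) {k w : ℕ} (hkw : k ≤ w)
    (W : Circuit (Fin k)) (hWB : W.IsOver B) :
    ∃ W' : Circuit (Fin w), W'.IsOver B ∧ W'.acDepth ≤ W.acDepth + 3 ∧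
      W'.size ≤ W.size + w + 2 ∧ W'.assignment = W.assignment := by
  have hnot : GateFn.not ∈ B := hB mem_acBasis_not
  -- the guard "all inputs `j ≥ k` are `0`"
  let gd : Fin w → (Fin w → Bool) → Bool := fun j y => if k ≤ (j : ℕ) then !y j else true
  have hgd : ∀ j, ACRealOver B (gd j) 1 1 := by
    intro j
    by_cases hj : k ≤ (j : ℕ)
    · simpa [gd, hj] using (acRealOver_notInput hnot j).mono (Nat.zero_le 1) le_rfl
    · simpa [gd, hj] using (acRealOver_const (ι := Fin w) hB true)
  have hguard : ACRealOver B (fun y : Fin w → Bool => decide (∀ j, gd j y = true)) 2 (w * 1 + 1) :=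
    acRealOver_forall_const hB hgd
  -- `W` on the low bits
  have hlow : ACRealOver B (fun y : Fin w → Bool => W.eval fun j : Fin k => y ⟨j, lt_of_lt_of_le j.2 hkw⟩)
      W.acDepth W.size :=
    (ACRealOver.of_circuit W hWB le_rfl le_rfl).rewire fun j : Fin k => (⟨j, lt_of_lt_of_le j.2 hkw⟩ : Fin w)
  have hboth := acRealOver_and₂ hB (hguard.mono (le_max_right W.acDepth 2) le_rfl)
    (hlow.mono (le_max_left W.acDepth 2) le_rfl)
  obtain ⟨W', hB', hd', hs', he'⟩ := hboth.toCircuit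
  refine ⟨W', hB', hd'.trans (by omega), hs'.trans (by omega), funext fun v => ?_⟩
  rcases lt_or_ge v (2 ^ w) with hv | hv
  · rw [← Circuit.eval_testBit_eq_assignment W' hv, he']
    beta_reduce
    rcases lt_or_ge v (2 ^ k) with hvk | hvk
    · rw [← Circuit.eval_testBit_eq_assignment W hvk]
      have hg : decide (∀ j : Fin w, gd j (fun j : Fin w => v.testBit j) = true) = true := by
        rw [decide_eq_true_eq]
        intro j
        by_cases hj : k ≤ (j : ℕ)
        · simp only [gd, hj, if_true, Bool.not_eq_true']
          exact Nat.testBit_lt_two_pow (hvk.trans_le (Nat.pow_le_pow_right Nat.two_pos hj))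
        · simp [gd, hj]
      rw [hg, Bool.true_and]
    · rw [Circuit.assignment_of_le W hvk]
      have hg : decide (∀ j : Fin w, gd j (fun j : Fin w => v.testBit j) = true) = false := by
        rw [decide_eq_false_iff_not]
        intro hall
        refine absurd (Nat.lt_pow_two_of_testBit v fun j hj => ?_) (not_lt.2 hvk)
        rcases lt_or_ge j w with hjw | hjw
        · have := hall ⟨j, hjw⟩
          simpa [gd, hj] using this
        · exact Nat.testBit_lt_two_pow (hv.trans_le (Nat.pow_le_pow_right Nat.two_pos hjw))
      rw [hg, Bool.false_and]
  · rw [Circuit.assignment_of_le W' hv,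
      Circuit.assignment_of_le W (le_trans (Nat.pow_le_pow_right Nat.two_pos hkw) hv)]

end Literature.Computability.Complexity
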